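import Mathlib
import HarnessLib
import Summits.HubbardSuperconductivity.HubbardSuperconductivity.Theorems.KLProgrammeFermiSurfaceFST3

/-!
# Route `KLProgramme` (cruxes K3/K1, risk r2): FST III's asymmetric hypothesis (H4′) over `FST3.AngularChart`
# is FALSE for every record carrying the Hubbard band, every `K_a`, every `-4 < μ < 0` — in ANY angular chart
# the chart antipode is `θ ↦ θ + a(0)`, so `∂a/∂θ ≡ 1`

Cell `gate-hubbard-kl`, seat fs-1, risk-register item r2 «Fermi-surface hypotheses at `δ ∈ [0.10, 0.20]`».
`FermiRG/FST3Main.lean` (typer t5) types FST II §2.3's (H4′) — the extra hypothesis of FST III Theorem 1.1 (ii) —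
over an `FST3.AngularChart M`: a `2π`-periodic differentiable constant-speed parametrisation `c = 𝐩(0,·)` of the
periodic Fermi surface with an antipode FUNCTION `a : ℝ → ℝ` as chart DATA, subject only to `e(c(a θ)) = 0` and
`c'(a θ) = -c'(θ)`, reading `∂a/∂θ := deriv a`. `KLProgrammeFermiSurfaceFST3` decided (H1)–(H4), (Sy) ✓, (H5) ✗;
`…FST2Param` §5 decided FST II's (A4′) ✗ (there `∂a/∂θ` is the curvature ratio). This module decides the LAST
typed Fermi-surface hypothesis, with no orientation-constancy / Darboux argument for the merely differentiable chart:
§1 two points of the periodic Fermi surface (`-4 < μ < 0`) with PARALLEL gradients are `q = ±p + γ`, `γ ∈ 2πℤ²`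
(cell reduction + `klfs_parallel_gradients`); §2 `2πℤ²` is closed, no `p ∈ S` has `2p ∈ 2πℤ²` (`∇e(p)` would
vanish), and continuous `2πℤ²`-valued maps are flat; §3 in a chart, `e ∘ c = 0` at `θ` and at `a θ` with
`c'(a θ) = -c'(θ) ≠ 0` makes the two gradients parallel (`d = 2`), so for EVERY `θ` either `c(a θ) + c θ ∈ 2πℤ²`
or `c(a θ) - c θ ∈ 2πℤ²`, never both; these closed alternatives cover `ℝ`, so one is all of `ℝ` (`isClopen_iff`);
the «−» one forces `a' ≡ -1`, a fixed point `θ*` of `a`, and `c'(θ*) = -c'(θ*) = 0` against the speed `1/P > 0`;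
hence **`c(a θ) + c θ ∈ 2πℤ²` for all `θ`**, **`deriv a ≡ 1`**, `a θ = θ + a(0)`, `c(a θ) = -c θ + γ` for ONE `γ`;
§4 **`¬ H4' M K_a`** (`klfs_fst3_not_h4'`): clause 1 of (H4′) («`∂a/∂θ = 1` exactly on the finite set `Θ + 2πℤ`»)
would make `ℝ` countable. Census: (H4) ✓ (Sy) ✓ (H4′) ✗ (H5) ✗ — so NEITHER variant of FST III Theorem 1.1 has
an instance for the Hubbard band on a programme window: (i) (`theorem11_i`: (Sy), (H5)) fails at (H5), (ii)
(`theorem11_ii`: (H4), (H4′), (H5)) at (H4′) and (H5); consumers take Theorem 1.2 (`…FermiSurfaceFST3Theorem11`).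
No definitions; everything PROVED; no record `M` is built (W-004: `he : M.e = fun p ↦ squareDispersion 1 0 p - μ`).
[folklore]
-/

noncomputable section

open Real Set Filter
open scoped Topology

-- the tree's namespace `Summit.<Summit>.<Problem>.Theorems` repeats the summit name by design (D-0017)
set_option linter.dupNamespace false

namespace Summit.HubbardSuperconductivity.HubbardSuperconductivity.Theorems

open Literature.MathematicalPhysics.QuantumLattice

/-! ### §1 Parallel normals on the periodic Fermi surface: `q = ±p` modulo `2πℤ²` -/

/-- **Gauss-map injectivity modulo the central symmetry, periodic form**: `p, q` on the periodic Fermi surface of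
`e = ε - μ` (`-4 < μ < 0`) with parallel gradients (`sin p₀ sin q₁ - sin p₁ sin q₀ = 0`) satisfy `q = ±p + γ`,
`γ ∈ 2πℤ²` (cell reduction to the polar graph `fermiPolar μ` + `klfs_parallel_gradients`). [folklore] -/
theorem klfs_parallel_normals_eq_or {μ : ℝ} (hμ₁ : -4 < μ) (hμ₂ : μ < 0) {p q : Momentum}
    (hp : squareDispersion 1 0 p - μ = 0) (hq : squareDispersion 1 0 q - μ = 0)
    (hcross : Real.sin (p 0) * Real.sin (q 1) - Real.sin (p 1) * Real.sin (q 0) = 0) :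
    (∃ γ ∈ (FermiRG.Crystal.cubic 2).dualLattice, q = p + γ) ∨
      (∃ γ ∈ (FermiRG.Crystal.cubic 2).dualLattice, q = -p + γ) := by
  obtain ⟨gp, hgp, -⟩ := (FermiRG.Crystal.cubic 2).existsUnique_rep p
  obtain ⟨gq, hgq, -⟩ := (FermiRG.Crystal.cubic 2).existsUnique_rep q
  have hsp : ∀ i, Real.sin ((p + (gp : Momentum)) i) = Real.sin (p i) := klfs_sin_add_dualLattice gp.2 p
  have hsq : ∀ i, Real.sin ((q + (gq : Momentum)) i) = Real.sin (q i) := klfs_sin_add_dualLattice gq.2 q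
  have hlev : ∀ (x : Momentum) (g : (FermiRG.Crystal.cubic 2).dualLattice), squareDispersion 1 0 x - μ = 0 →
      sqDispersion (WithLp.ofLp (x + (g : Momentum))) = μ := by
    intro x g hx
    have hper := klfs_isLatticePeriodic_e μ (g : Momentum) g.2 x
    beta_reduce at hper
    rw [← squareDispersion_one_zero_eq_sqDispersion]; linarith
  obtain ⟨θ, -, hθ⟩ := exists_fermiPolar_eq hμ₁ hμ₂ (klfs_supNorm_le_pi_of_mem_cell hgp) (hlev p gp hp)
  obtain ⟨φ, -, hφ⟩ := exists_fermiPolar_eq hμ₁ hμ₂ (klfs_supNorm_le_pi_of_mem_cell hgq) (hlev q gq hq)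
  have hX : ∀ ψ, fermiPolar μ ψ 0 = bandX μ ψ := fun ψ => fermiPolar_apply_zero μ ψ
  have hY : ∀ ψ, fermiPolar μ ψ 1 = bandY μ ψ := fun ψ => fermiPolar_apply_one μ ψ
  have hp0 : Real.sin (bandX μ θ) = Real.sin (p 0) := by rw [← hX, hθ, hsp]
  have hp1 : Real.sin (bandY μ θ) = Real.sin (p 1) := by rw [← hY, hθ, hsp]
  have hq0 : Real.sin (bandX μ φ) = Real.sin (q 0) := by rw [← hX, hφ, hsq]
  have hq1 : Real.sin (bandY μ φ) = Real.sin (q 1) := by rw [← hY, hφ, hsq]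
  have hcross' : Real.sin (bandX μ θ) * Real.sin (bandY μ φ) -
      Real.sin (bandY μ θ) * Real.sin (bandX μ φ) = 0 := by
    rw [hp0, hp1, hq0, hq1]; linear_combination hcross
  obtain ⟨σ, hσ, hσX, hσY⟩ := klfs_parallel_gradients hμ₁ hμ₂ hcross'
  rcases hσ with rfl | rfl
  · left -- same point in the cell: `q + gq = p + gp`
    have hqp : q + (gq : Momentum) = p + (gp : Momentum) := by
      rw [← hφ, ← hθ]
      ext i
      fin_cases i
      · show fermiPolar μ φ 0 = fermiPolar μ θ 0
        rw [hX, hX, hσX, one_mul]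
      · show fermiPolar μ φ 1 = fermiPolar μ θ 1
        rw [hY, hY, hσY, one_mul]
    refine ⟨(gp : Momentum) - (gq : Momentum), Submodule.sub_mem _ gp.2 gq.2, ?_⟩
    have := congrArg (fun v => v - (gq : Momentum)) hqp
    simp only [add_sub_cancel_right] at this
    rw [this]; abel
  · right -- opposite points in the cell: `q + gq = -(p + gp)`
    have hqp : q + (gq : Momentum) = -(p + (gp : Momentum)) := by
      rw [← hφ, ← hθ]
      ext i
      fin_cases i
      · show fermiPolar μ φ 0 = (-fermiPolar μ θ) 0
        rw [PiLp.neg_apply, hX, hX, hσX, neg_one_mul]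
      · show fermiPolar μ φ 1 = (-fermiPolar μ θ) 1
        rw [PiLp.neg_apply, hY, hY, hσY, neg_one_mul]
    refine ⟨-(gp : Momentum) - (gq : Momentum), Submodule.sub_mem _ (Submodule.neg_mem _ gp.2) gq.2, ?_⟩
    have := congrArg (fun v => v - (gq : Momentum)) hqp
    simp only [add_sub_cancel_right] at this
    rw [this]; abel

/-! ### §2 The lattice `2πℤ²`: closed, misses `2S`, and `2πℤ²`-valued continuous maps are flat -/

/-- `2πℤ²` is a closed subset of momentum space (its points are `2π`-separated). [folklore] -/
theorem klfs_dualLattice_isClosed :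
    IsClosed ((FermiRG.Crystal.cubic 2).dualLattice : Set Momentum) := by
  refine Metric.isClosed_of_pairwise_le_dist Real.two_pi_pos fun x hx y hy hne => ?_
  show 2 * π ≤ dist x y
  rw [dist_eq_norm]
  exact klfs_dualLattice_norm_ge (Submodule.sub_mem _ hx hy) (sub_ne_zero.2 hne)

/-- **No point of the Fermi surface is a half-lattice point**: `p ∈ S` (`-4 < μ < 0`) has `2p ∉ 2πℤ²` (else
`sin pᵢ = 0` and `∇e(p) = 0`; the classes `(0,0), (π,0), (0,π), (π,π)` have `ε = -4, 0, 0, 4 ≠ μ`). [folklore] -/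
theorem klfs_add_self_not_mem_dualLattice {μ : ℝ} (hμ₁ : -4 < μ) (hμ₂ : μ < 0) {p : Momentum}
    (hp : squareDispersion 1 0 p - μ = 0) : p + p ∉ (FermiRG.Crystal.cubic 2).dualLattice := by
  intro hmem
  have hsin : ∀ i, Real.sin (p i) = 0 := by
    intro i
    obtain ⟨n, hn⟩ := klfs_dualLattice_coord hmem i
    have hpi : p i = (n : ℝ) * π := by
      have h2 : p i + p i = 2 * π * n := by simpa using hn
      linarith
    rw [hpi, Real.sin_int_mul_pi]
  have h0 : gradient (squareDispersion 1 0) p = 0 := by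
    rw [gradient_squareDispersion]; ext i; fin_cases i <;> simp [hsin 0, hsin 1]
  exact klfs_gradient_e_ne_zero hμ₁ hμ₂ (klfs_mem_fermiSurface_iff.2 (by linarith))
    (by rw [klfs_gradient_level]; exact h0)

/-- A `2πℤ²`-valued map `ℝ → ℝ²` continuous at `t` is constant near `t`, so has derivative `0` there. [folklore] -/
theorem klfs_hasDerivAt_zero_of_mem_dualLattice {F : ℝ → Momentum} {t : ℝ} (hF : ContinuousAt F t)
    (hΛ : ∀ s, F s ∈ (FermiRG.Crystal.cubic 2).dualLattice) : HasDerivAt F 0 t := by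
  have hev : F =ᶠ[𝓝 t] fun _ => F t := by
    have hball : ∀ᶠ s in 𝓝 t, F s ∈ Metric.ball (F t) (2 * π) :=
      hF.preimage_mem_nhds (Metric.ball_mem_nhds _ Real.two_pi_pos)
    filter_upwards [hball] with s hs
    by_contra hne
    have hge := klfs_dualLattice_norm_ge (Submodule.sub_mem _ (hΛ s) (hΛ t)) (sub_ne_zero.2 hne)
    rw [Metric.mem_ball, dist_eq_norm] at hs
    linarith
  exact (hasDerivAt_const t (F t)).congr_of_eventuallyEq hev

/-! ### §3 Angular charts of the Hubbard band: the chart antipode is a translate of the identity -/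

/-- **Tangency in a chart**: `⟪∇e(c θ), c'(θ)⟫ = 0`, i.e. `sin c₀ · c₀' + sin c₁ · c₁' = 0` (`e ∘ c ≡ 0`). [folklore] -/
theorem klfs_angularChart_tangent {μ : ℝ} (M : FermiRG.FST3.Model 2)
    (he : M.e = fun p : Momentum => squareDispersion 1 0 p - μ) (A : FermiRG.FST3.AngularChart M) (θ : ℝ) :
    Real.sin (A.curve θ 0) * deriv A.curve θ 0 + Real.sin (A.curve θ 1) * deriv A.curve θ 1 = 0 := by
  set P0 : Momentum →L[ℝ] ℝ := PiLp.proj 2 (fun _ : Fin 2 => ℝ) 0 with hP0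
  set P1 : Momentum →L[ℝ] ℝ := PiLp.proj 2 (fun _ : Fin 2 => ℝ) 1 with hP1
  have hcomp : HasDerivAt (fun s => squareDispersion 1 0 (A.curve s) - μ)
      (((2 * Real.sin (A.curve θ 0)) • P0 + (2 * Real.sin (A.curve θ 1)) • P1) (deriv A.curve θ)) θ :=
    (klfs_hasFDerivAt_e μ (A.curve θ)).comp_hasDerivAt θ (A.differentiable θ).hasDerivAt
  have hzero : HasDerivAt (fun s => squareDispersion 1 0 (A.curve s) - μ) 0 θ := by
    have hfun : (fun s => squareDispersion 1 0 (A.curve s) - μ) = fun _ => 0 := by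
      funext s; have hs := A.onSurface s; rwa [he] at hs
    rw [hfun]; exact hasDerivAt_const θ 0
  have h := hcomp.unique hzero
  simp [hP0, hP1] at h
  linarith

/-- In a chart the speed is `1/P > 0`, so `c'(θ) ≠ 0`. [folklore] -/
theorem klfs_angularChart_deriv_curve_ne_zero {M : FermiRG.FST3.Model 2} (A : FermiRG.FST3.AngularChart M)
    (θ : ℝ) : deriv A.curve θ ≠ 0 := by
  intro h0
  have h := A.speed θ; rw [h0, norm_zero] at h; exact absurd h (ne_of_lt A.invP_pos)

/-- **The gradients at `c θ` and `c(a θ)` are parallel** (`d = 2`): both are `⊥ c'(θ) = -c'(a θ) ≠ 0`. [folklore] -/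
theorem klfs_angularChart_cross {μ : ℝ} (M : FermiRG.FST3.Model 2)
    (he : M.e = fun p : Momentum => squareDispersion 1 0 p - μ) (A : FermiRG.FST3.AngularChart M) (θ : ℝ) :
    Real.sin (A.curve θ 0) * Real.sin (A.curve (A.antipode θ) 1) -
      Real.sin (A.curve θ 1) * Real.sin (A.curve (A.antipode θ) 0) = 0 := by
  have hu := klfs_angularChart_tangent M he A θ
  have hv := klfs_angularChart_tangent M he A (A.antipode θ)
  rw [(A.antipode_spec θ).2] at hv
  simp only [PiLp.neg_apply] at hv
  set w := deriv A.curve θ with hw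
  have hw0 : w ≠ 0 := klfs_angularChart_deriv_curve_ne_zero A θ
  have hcoord : w 0 ≠ 0 ∨ w 1 ≠ 0 := by
    by_contra h
    push Not at h
    apply hw0
    ext i; fin_cases i
    · simpa using h.1
    · simpa using h.2
  have h1 : (Real.sin (A.curve θ 0) * Real.sin (A.curve (A.antipode θ) 1) -
      Real.sin (A.curve θ 1) * Real.sin (A.curve (A.antipode θ) 0)) * w 0 = 0 := by
    linear_combination (Real.sin (A.curve (A.antipode θ) 1)) * hu + (Real.sin (A.curve θ 1)) * hv
  have h2 : (Real.sin (A.curve θ 0) * Real.sin (A.curve (A.antipode θ) 1) -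
      Real.sin (A.curve θ 1) * Real.sin (A.curve (A.antipode θ) 0)) * w 1 = 0 := by
    linear_combination (-(Real.sin (A.curve θ 0))) * hv + (-(Real.sin (A.curve (A.antipode θ) 0))) * hu
  rcases hcoord with h | h
  · exact (mul_eq_zero.1 h1).resolve_right h
  · exact (mul_eq_zero.1 h2).resolve_right h

/-- **Pointwise dichotomy**: `c(a θ) + c θ ∈ 2πℤ²` or `c(a θ) - c θ ∈ 2πℤ²`, for every `θ` (§1). [folklore] -/
theorem klfs_angularChart_mem_or {μ : ℝ} (hμ₁ : -4 < μ) (hμ₂ : μ < 0) (M : FermiRG.FST3.Model 2)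
    (he : M.e = fun p : Momentum => squareDispersion 1 0 p - μ) (A : FermiRG.FST3.AngularChart M) (θ : ℝ) :
    A.curve (A.antipode θ) + A.curve θ ∈ (FermiRG.Crystal.cubic 2).dualLattice ∨
      A.curve (A.antipode θ) - A.curve θ ∈ (FermiRG.Crystal.cubic 2).dualLattice := by
  have hp : squareDispersion 1 0 (A.curve θ) - μ = 0 := by
    have h := A.onSurface θ; rwa [he] at h
  have hq : squareDispersion 1 0 (A.curve (A.antipode θ)) - μ = 0 := by
    have h := (A.antipode_spec θ).1; rwa [he] at h
  rcases klfs_parallel_normals_eq_or hμ₁ hμ₂ hp hq (klfs_angularChart_cross M he A θ) with ⟨γ, hγ, h⟩ | ⟨γ, hγ, h⟩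
  · right; rw [h, add_sub_cancel_left]; exact hγ
  · left; rw [h, neg_add_cancel_comm]; exact hγ

/-- **The two alternatives exclude each other**: both at once would put `2 c(θ) ∈ 2πℤ²` (§2). [folklore] -/
theorem klfs_angularChart_not_mem_and {μ : ℝ} (hμ₁ : -4 < μ) (hμ₂ : μ < 0) (M : FermiRG.FST3.Model 2)
    (he : M.e = fun p : Momentum => squareDispersion 1 0 p - μ) (A : FermiRG.FST3.AngularChart M) (θ : ℝ) :
    ¬ (A.curve (A.antipode θ) + A.curve θ ∈ (FermiRG.Crystal.cubic 2).dualLattice ∧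
      A.curve (A.antipode θ) - A.curve θ ∈ (FermiRG.Crystal.cubic 2).dualLattice) := by
  rintro ⟨hplus, hminus⟩
  have hp : squareDispersion 1 0 (A.curve θ) - μ = 0 := by
    have h := A.onSurface θ; rwa [he] at h
  have h2 : A.curve θ + A.curve θ ∈ (FermiRG.Crystal.cubic 2).dualLattice := by
    have h := Submodule.sub_mem _ hplus hminus
    rwa [show A.curve (A.antipode θ) + A.curve θ - (A.curve (A.antipode θ) - A.curve θ) =
      A.curve θ + A.curve θ by abel] at h
  exact klfs_add_self_not_mem_dualLattice hμ₁ hμ₂ hp h2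

/-- Chain rule for `c ∘ a` in a chart: `(c ∘ a)'(θ) = a'(θ) • c'(a θ) = a'(θ) • (-c'(θ))`. [folklore] -/
theorem klfs_angularChart_hasDerivAt_comp {M : FermiRG.FST3.Model 2} (A : FermiRG.FST3.AngularChart M) (θ : ℝ) :
    HasDerivAt (fun s => A.curve (A.antipode s)) (deriv A.antipode θ • -deriv A.curve θ) θ := by
  have h := HasDerivAt.scomp θ (A.differentiable (A.antipode θ)).hasDerivAt (A.antipode_differentiable θ).hasDerivAt
  rw [(A.antipode_spec θ).2] at h
  exact h

/-- **In every angular chart of the Hubbard band, `c(a θ) + c(θ) ∈ 2πℤ²` for ALL `θ`** (`-4 < μ < 0`): the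
set where this holds and the set where `c(a θ) - c(θ) ∈ 2πℤ²` are closed (§2), cover `ℝ` and are disjoint
(§3), so the first is clopen, i.e. `∅` or `ℝ`; were it empty, `c ∘ a - c` would be lattice-valued, hence
flat, forcing `a' ≡ -1`, `a θ = a(0) - θ`, and at the fixed point `θ* = a(0)/2` the chart axiom
`c'(a θ*) = -c'(θ*)` would give `c'(θ*) = 0`, contradicting the constant speed `1/P > 0`. [folklore] -/
theorem klfs_angularChart_antipode_add_mem {μ : ℝ} (hμ₁ : -4 < μ) (hμ₂ : μ < 0) (M : FermiRG.FST3.Model 2)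
    (he : M.e = fun p : Momentum => squareDispersion 1 0 p - μ) (A : FermiRG.FST3.AngularChart M) (θ : ℝ) :
    A.curve (A.antipode θ) + A.curve θ ∈ (FermiRG.Crystal.cubic 2).dualLattice := by
  have hca : Continuous fun s => A.curve (A.antipode s) :=
    A.differentiable.continuous.comp A.antipode_differentiable.continuous
  have hFc : Continuous fun s => A.curve (A.antipode s) + A.curve s := hca.add A.differentiable.continuous
  have hGc : Continuous fun s => A.curve (A.antipode s) - A.curve s := hca.sub A.differentiable.continuous
  set Sp : Set ℝ := {s | A.curve (A.antipode s) + A.curve s ∈ (FermiRG.Crystal.cubic 2).dualLattice} with hSp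
  have hSp_closed : IsClosed Sp := klfs_dualLattice_isClosed.preimage hFc
  have hSm_closed : IsClosed {s | A.curve (A.antipode s) - A.curve s ∈ (FermiRG.Crystal.cubic 2).dualLattice} :=
    klfs_dualLattice_isClosed.preimage hGc
  have hcompl : Spᶜ = {s | A.curve (A.antipode s) - A.curve s ∈ (FermiRG.Crystal.cubic 2).dualLattice} := by
    ext s
    simp only [hSp, Set.mem_compl_iff, Set.mem_setOf_eq]
    constructor
    · exact fun h => (klfs_angularChart_mem_or hμ₁ hμ₂ M he A s).resolve_left h
    · exact fun h h' => klfs_angularChart_not_mem_and hμ₁ hμ₂ M he A s ⟨h', h⟩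
  have hSp_open : IsOpen Sp := by rw [← compl_compl Sp, hcompl]; exact hSm_closed.isOpen_compl
  rcases isClopen_iff.1 ⟨hSp_closed, hSp_open⟩ with hempty | huniv
  · -- the «−» alternative everywhere: `a' ≡ -1`, a fixed point of `a`, and `c' = 0` there
    exfalso
    have hGmem : ∀ s, A.curve (A.antipode s) - A.curve s ∈ (FermiRG.Crystal.cubic 2).dualLattice := by
      intro s
      have hs : s ∈ Spᶜ := by rw [hempty, Set.compl_empty]; exact Set.mem_univ s
      rw [hcompl] at hs
      exact hs
    have hda : ∀ s, deriv A.antipode s = -1 := by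
      intro s
      have h0 : HasDerivAt (fun s => A.curve (A.antipode s) - A.curve s) 0 s :=
        klfs_hasDerivAt_zero_of_mem_dualLattice hGc.continuousAt hGmem
      have h1 : HasDerivAt (fun s => A.curve (A.antipode s) - A.curve s)
          (deriv A.antipode s • -deriv A.curve s - deriv A.curve s) s :=
        (klfs_angularChart_hasDerivAt_comp A s).sub (A.differentiable s).hasDerivAt
      have h := h1.unique h0
      have key : (-(deriv A.antipode s + 1)) • deriv A.curve s =
          deriv A.antipode s • -deriv A.curve s - deriv A.curve s := by
        simp only [neg_smul, add_smul, one_smul, smul_neg]; abel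
      rw [h] at key
      rcases smul_eq_zero.1 key with h' | h'
      · linarith [neg_eq_zero.1 h']
      · exact absurd h' (klfs_angularChart_deriv_curve_ne_zero A s)
    have hconst : ∀ s, A.antipode s + s = A.antipode 0 := by
      intro s
      have hd : Differentiable ℝ fun s => A.antipode s + s := A.antipode_differentiable.add differentiable_id
      have hd0 : ∀ s, deriv (fun s => A.antipode s + s) s = 0 := by
        intro s
        have h : HasDerivAt (fun s => A.antipode s + s) (deriv A.antipode s + 1) s :=
          (A.antipode_differentiable s).hasDerivAt.add (hasDerivAt_id s)
        rw [h.deriv, hda]; ring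
      have h := is_const_of_deriv_eq_zero hd hd0 s 0
      simpa using h
    set θs := A.antipode 0 / 2 with hθs
    have hfix : A.antipode θs = θs := by have h := hconst θs; rw [hθs] at h ⊢; linarith
    have hsp := (A.antipode_spec θs).2
    rw [hfix] at hsp
    have h2 : (2 : ℝ) • deriv A.curve θs = 0 := by
      rw [two_smul]; nth_rewrite 2 [hsp]; exact add_neg_cancel (deriv A.curve θs)
    exact klfs_angularChart_deriv_curve_ne_zero A θs ((smul_eq_zero.1 h2).resolve_left two_ne_zero)
  · have hθ : θ ∈ Sp := by rw [huniv]; exact Set.mem_univ θ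
    exact hθ

/-- **`∂a/∂θ ≡ 1` in every angular chart of the Hubbard band** (`-4 < μ < 0`): `c ∘ a + c` is
`2πℤ²`-valued and continuous, hence flat, so `a'(θ) • (-c'(θ)) + c'(θ) = (1 - a'(θ)) • c'(θ) = 0` with
`c'(θ) ≠ 0`. [folklore] -/
theorem klfs_angularChart_deriv_antipode {μ : ℝ} (hμ₁ : -4 < μ) (hμ₂ : μ < 0) (M : FermiRG.FST3.Model 2)
    (he : M.e = fun p : Momentum => squareDispersion 1 0 p - μ) (A : FermiRG.FST3.AngularChart M) (θ : ℝ) :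
    deriv A.antipode θ = 1 := by
  have hFc : Continuous fun s => A.curve (A.antipode s) + A.curve s :=
    (A.differentiable.continuous.comp A.antipode_differentiable.continuous).add A.differentiable.continuous
  have h0 : HasDerivAt (fun s => A.curve (A.antipode s) + A.curve s) 0 θ :=
    klfs_hasDerivAt_zero_of_mem_dualLattice hFc.continuousAt (klfs_angularChart_antipode_add_mem hμ₁ hμ₂ M he A)
  have h1 : HasDerivAt (fun s => A.curve (A.antipode s) + A.curve s)
      (deriv A.antipode θ • -deriv A.curve θ + deriv A.curve θ) θ :=
    (klfs_angularChart_hasDerivAt_comp A θ).add (A.differentiable θ).hasDerivAt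
  have h := h1.unique h0
  have key : (1 - deriv A.antipode θ) • deriv A.curve θ = deriv A.antipode θ • -deriv A.curve θ + deriv A.curve θ := by
    rw [sub_smul, one_smul, smul_neg]; abel
  rw [h] at key
  rcases smul_eq_zero.1 key with h' | h'
  · linarith [sub_eq_zero.1 h']
  · exact absurd h' (klfs_angularChart_deriv_curve_ne_zero A θ)

/-- **The chart antipode is a translate of the identity**: `a θ = θ + a(0)` for all `θ` (under (Sy) FST II
writes `a(θ) = θ + π`; the typed chart fixes `a` only up to the `2π`-ambiguity of the datum, whence the
constant `a(0)`). [folklore] -/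
theorem klfs_angularChart_antipode_eq {μ : ℝ} (hμ₁ : -4 < μ) (hμ₂ : μ < 0) (M : FermiRG.FST3.Model 2)
    (he : M.e = fun p : Momentum => squareDispersion 1 0 p - μ) (A : FermiRG.FST3.AngularChart M) (θ : ℝ) :
    A.antipode θ = θ + A.antipode 0 := by
  have hd : Differentiable ℝ fun s => A.antipode s - s := A.antipode_differentiable.sub differentiable_id
  have hd0 : ∀ s, deriv (fun s => A.antipode s - s) s = 0 := by
    intro s
    have h : HasDerivAt (fun s => A.antipode s - s) (deriv A.antipode s - 1) s :=
      (A.antipode_differentiable s).hasDerivAt.sub (hasDerivAt_id s)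
    rw [h.deriv, klfs_angularChart_deriv_antipode hμ₁ hμ₂ M he A s, sub_self]
  have h := is_const_of_deriv_eq_zero hd hd0 θ 0
  simp only [sub_zero] at h
  linarith

/-- **The chart antipode point is `-c(θ)` up to ONE lattice vector**: there is `γ ∈ 2πℤ²` with
`c(a θ) = -c(θ) + γ` for all `θ` (the flat lattice-valued map `c ∘ a + c` is constant). [folklore] -/
theorem klfs_angularChart_curve_antipode {μ : ℝ} (hμ₁ : -4 < μ) (hμ₂ : μ < 0) (M : FermiRG.FST3.Model 2)
    (he : M.e = fun p : Momentum => squareDispersion 1 0 p - μ) (A : FermiRG.FST3.AngularChart M) :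
    ∃ γ ∈ (FermiRG.Crystal.cubic 2).dualLattice, ∀ θ, A.curve (A.antipode θ) = -A.curve θ + γ := by
  have hFc : Continuous fun s => A.curve (A.antipode s) + A.curve s :=
    (A.differentiable.continuous.comp A.antipode_differentiable.continuous).add A.differentiable.continuous
  have hmem := klfs_angularChart_antipode_add_mem hμ₁ hμ₂ M he A
  have hd : Differentiable ℝ fun s => A.curve (A.antipode s) + A.curve s := fun s =>
    (klfs_hasDerivAt_zero_of_mem_dualLattice hFc.continuousAt hmem (t := s)).differentiableAt
  have hd0 : ∀ s, deriv (fun s => A.curve (A.antipode s) + A.curve s) s = 0 := fun s =>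
    (klfs_hasDerivAt_zero_of_mem_dualLattice hFc.continuousAt hmem (t := s)).deriv
  refine ⟨A.curve (A.antipode 0) + A.curve 0, hmem 0, fun θ => ?_⟩
  have h := is_const_of_deriv_eq_zero hd hd0 θ 0
  rw [← sub_eq_iff_eq_add', sub_neg_eq_add]
  exact h

/-! ### §4 (H4′) is false for the Hubbard band; the census -/

/-- **FST III's asymmetric hypothesis (H4′) is FALSE for any record carrying the Hubbard band**, for EVERY
constant `K_a` and every `-4 < μ < 0`: in any angular chart `∂a/∂θ ≡ 1` (`klfs_angularChart_deriv_antipode`),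
so clause 1 of (H4′) — «`∂a/∂θ = 1` only at the finitely many classes `θ^{(1)}, …, θ^{(N)}` mod `2π`» —
would make `ℝ = Θ + 2πℤ` countable. FST II §2.3 states (H4′) «for `d = 2` and `e` not obeying (Sy)»; the
Hubbard band obeys (Sy), and the typed form is refuted outright. [folklore] -/
theorem klfs_fst3_not_h4' {μ : ℝ} (hμ₁ : -4 < μ) (hμ₂ : μ < 0) (M : FermiRG.FST3.Model 2)
    (he : M.e = fun p : Momentum => squareDispersion 1 0 p - μ) (Ka : ℝ) : ¬ FermiRG.FST3.H4' M Ka := by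
  rintro ⟨-, A, Θ, δ₀, -, hzero, -, -, -⟩
  have h1 := klfs_angularChart_deriv_antipode hμ₁ hμ₂ M he A
  have hcover : (Set.univ : Set ℝ) ⊆ ⋃ θ₀ ∈ (Θ : Set ℝ), Set.range fun m : ℤ => θ₀ + 2 * Real.pi * m := by
    intro θ _
    obtain ⟨θ₀, hθ₀, m, hm⟩ := (hzero θ).1 (h1 θ)
    exact Set.mem_biUnion hθ₀ ⟨m, hm.symm⟩
  have hcount : (⋃ θ₀ ∈ (Θ : Set ℝ), Set.range fun m : ℤ => θ₀ + 2 * Real.pi * m).Countable :=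
    Set.Countable.biUnion Θ.countable_toSet fun θ₀ _ => Set.countable_range _
  exact Cardinal.not_countable_real (hcount.mono hcover)

/-- **Census of FST III's antipode hypotheses for the Hubbard record** (every `-4 < μ < 0`): (Sy) ✓ and (H4) ✓
(`KLProgrammeFermiSurfaceFST3`), (H4′) ✗ for every `K_a` — so of the two typed variants of FST III Theorem 1.1,
variant (ii) (`theorem11_ii`, hypotheses (H4), (H4′), (H5)) is NEVER instantiable for the Hubbard band, and variant
(i) (`theorem11_i`, (Sy), (H5)) exactly when `μ < -2` ((H5) by `klfs_fst3_h5_iff`); else Theorem 1.2. [folklore] -/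
theorem klfs_fst3_census_h4' {μ : ℝ} (hμ₁ : -4 < μ) (hμ₂ : μ < 0) (M : FermiRG.FST3.Model 2)
    (he : M.e = fun p : Momentum => squareDispersion 1 0 p - μ) :
    FermiRG.FST3.Sy M ∧ FermiRG.FST3.H4 M ∧ (∀ Ka : ℝ, ¬ FermiRG.FST3.H4' M Ka) ∧
      ∀ A : FermiRG.FST3.AngularChart M, (∀ θ, deriv A.antipode θ = 1) ∧ ∀ θ, A.antipode θ = θ + A.antipode 0 :=
  ⟨klfs_fst3_sy M he, klfs_fst3_h4 hμ₁ hμ₂ M he, klfs_fst3_not_h4' hμ₁ hμ₂ M he, fun A =>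
    ⟨klfs_angularChart_deriv_antipode hμ₁ hμ₂ M he A, klfs_angularChart_antipode_eq hμ₁ hμ₂ M he A⟩⟩

/-- **On the programme's windows** (doping window of record `μ ∈ [-0.4275, -0.1775]` ⊃ `μ([0.10, 0.20])`,
analysis `[-1, -0.15]`, extended certificate `[-0.5725, -0.075]`, covariance `klWindowC = [-1.05, -0.15]`): (H4′)
fails for every `K_a` and (H5) fails, for any record carrying the Hubbard band with the cell of `Crystal.cubic 2`
— so NO variant of FST III Theorem 1.1 applies there ((i) needs (H5); (ii) needs (H4′) and (H5)). [folklore] -/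
theorem klfs_windows_fst3_not_h4' {μ : ℝ}
    (hμ : μ ∈ Icc (-0.4275 : ℝ) (-0.1775) ∨ μ ∈ Icc (-1 : ℝ) (-0.15) ∨ μ ∈ Icc (-0.5725 : ℝ) (-0.075) ∨
      μ ∈ Icc (-1.05 : ℝ) (-0.15))
    (M : FermiRG.FST3.Model 2) (he : M.e = fun p : Momentum => squareDispersion 1 0 p - μ)
    (hF : M.fund = (FermiRG.Crystal.cubic 2).fundamentalDomain) :
    (∀ Ka : ℝ, ¬ FermiRG.FST3.H4' M Ka) ∧ ¬ FermiRG.FST3.H5 M := by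
  have hμ₁ : -4 < μ := by rcases hμ with h | h | h | h <;> linarith [h.1]
  have hμ₂ : μ < 0 := by rcases hμ with h | h | h | h <;> linarith [h.2]
  refine ⟨klfs_fst3_not_h4' hμ₁ hμ₂ M he, ?_⟩
  rw [klfs_fst3_h5_iff (by linarith) hμ₂ M he hF]
  rcases hμ with h | h | h | h <;> linarith [h.1]

end Summit.HubbardSuperconductivity.HubbardSuperconductivity.Theorems

end
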